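import Summits.Ventures.YMGap.SlabSpecification
import HarnessLib

/-!
# Venture YMGap, track (a) / A4, part 2 — the single-site Dobrushin DOOR of the slab σ-model
# (finite volume, boundary-uniform covariance decay from a one-link Kantorovich–Rubinstein modulus)

HONEST FRAMING: venture file of the cell `pub-ymgap` (QuantumFields programme). With its sibling `SlabSpecification` it formalises the
finite-volume slab σ-model used by Durhuus–Fröhlich (CMP 75 (1980)) and by Cao–Nissim–Sheffield (arXiv:2509.04688, Def. 2.1,
Thm. 2.3) to derive the Wilson AREA LAW at strong coupling, and proves the «Dobrushin door» for it: a one-link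
Kantorovich–Rubinstein modulus (the tree's named hypothesis `OneLinkKRModulus N R K`, decided off-kernel for
`SU(2)`) with `2(d-1)|β| K < 1` gives covariance decay of single-site bounded Lipschitz observables, UNIFORM in
the boundary fields and the volume.  Strong-coupling LATTICE statement only; no continuum limit, no mass-gap or
Clay claim; the area-law conclusion itself is NOT drawn in this file (it needs DF80/CNS25 Thm. 2.3 as a named
Literature fact, to be supplied by the cell's lit seat).  Specification of the task: `HOME/p2/SLAB-DOOR.md`.

Model (CNS25 Def. 2.1, 't Hooft scaling): slice `Λ = (ℤ/L)^n` (`n = d-1`), spins `Q_x ∈ SU(N)`, positively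
oriented edges `e = (x, i)` from `x` to `x + e_i`, boundary fields `A_e, B_e ∈ U(N)`,
`S_{A,B}(Q) = N β ∑_e Re tr(Q_x A_e Q_{x+e_i}⁻¹ B_e⁻¹)`, `μ_{A,B} ∝ exp(S_{A,B}) ∏ dQ_x`.
-/

noncomputable section

open MeasureTheory Filter Topology Function ProbabilityTheory
open scoped NNReal Matrix
open Literature.Probability.LatticeModels Literature.Probability.LatticeModels.DobrushinMetric
open Literature.MathematicalPhysics.QuantumLattice
open Literature.MathematicalPhysics.QuantumFieldTheory
open Literature.MathematicalPhysics.QuantumFieldTheory.Balaban1983to89.StrongCouplingDobrushinWindow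

namespace Summit.Ventures.YMGap.Slab

variable {n L N : ℕ} [NeZero L]

/-! ### The single-site Dobrushin structure of the slab model -/

/-- The **interaction neighbourhood** of a site: the endpoints of the edges at `x` (`2n` of them for `L ≥ 3`).
[cite: CaoNissimSheffield2025dynamical, Def. 2.1] -/
def slabNbr (x : TorusSite n L) : Finset (TorusSite n L) :=
  (outEdges x).image SlabEdge.tgt ∪ (inEdges x).image Prod.fst

/-- No site is its own neighbour (no loops, `L ≠ 1`). [folklore] -/
theorem not_mem_slabNbr (hL : ∀ e : SlabEdge n L, e.tgt ≠ e.1) (x : TorusSite n L) : x ∉ slabNbr x := by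
  classical
  simp only [slabNbr, Finset.mem_union, Finset.mem_image, outEdges, inEdges, Finset.mem_filter,
    Finset.mem_univ, true_and, not_or, not_exists, not_and]
  exact ⟨fun e he htgt => hL e (htgt.trans he.symm), fun e he h1 => hL e (he.trans h1.symm)⟩

/-- The slab staple sum at `x` reads the configuration only on `slabNbr x`. [folklore] -/
theorem slabStapleSum_congr (A B : SlabEdge n L → Matrix.unitaryGroup (Fin N) ℂ) (x : TorusSite n L)
    {η η' : SlabConfig n L N} (h : ∀ z ∈ slabNbr x, η z = η' z) :
    slabStapleSum A B η x = slabStapleSum A B η' x := by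
  classical
  unfold slabStapleSum
  congr 1
  · refine Finset.sum_congr rfl fun e he => ?_
    rw [h e.tgt (Finset.mem_union_left _ (Finset.mem_image_of_mem _ he))]
  · refine Finset.sum_congr rfl fun e he => ?_
    rw [h e.1 (Finset.mem_union_right _ (Finset.mem_image_of_mem _ he))]

/-- **Row sums of the influence count**: `∑_{y ∈ nbr x} m(x, y) ≤ 2n` (`= 2(d-1)`, against `6(d-1)` for the full
lattice model). [folklore] -/
theorem sum_slabInfluence_le (x : TorusSite n L) : ∑ y ∈ slabNbr x, slabInfluence x y ≤ 2 * n := by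
  classical
  unfold slabInfluence
  rw [Finset.sum_add_distrib]
  have h1 : ∑ y ∈ slabNbr x, ((outEdges x).filter fun e => e.tgt = y).card = (outEdges x).card :=
    (Finset.card_eq_sum_card_fiberwise (f := SlabEdge.tgt) (s := outEdges x) (t := slabNbr x)
      fun e he => Finset.mem_union_left _ (Finset.mem_image_of_mem _ he)).symm
  have h2 : ∑ y ∈ slabNbr x, ((inEdges x).filter fun e => e.1 = y).card = (inEdges x).card :=
    (Finset.card_eq_sum_card_fiberwise (f := Prod.fst) (s := inEdges x) (t := slabNbr x)
      fun e he => Finset.mem_union_right _ (Finset.mem_image_of_mem _ he)).symm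
  rw [h1, h2]
  have := card_outEdges_le x
  have := card_inEdges_le (n := n) (L := L) x
  omega

/-- **The slab specification satisfies Dobrushin's condition in the Kantorovich–Rubinstein form** with influence
coefficients `C(x,y) = K |β| m(x,y)`, given a one-link modulus `K` on the ball of radius `R ≥ 2n|β|` — the slab
analogue of the YM door's contraction step (`dlrMassGap_of_oneLinkKRModulus`).
[cite: Follmer1988, Ch. I (2.20)] [cite: arXiv220412737, remark after Thm. 1.3 (Dobrushin route)] -/
theorem isKRContraction_slabSpec (hN : 1 ≤ N) (hL : ∀ e : SlabEdge n L, e.tgt ≠ e.1) {β R K : ℝ} (hK : 0 ≤ K)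
    (hR : |β| * (2 * (n : ℝ)) ≤ R) (hmod : OneLinkKRModulus N R K)
    (A B : SlabEdge n L → Matrix.unitaryGroup (Fin N) ℂ) :
    IsKRContraction (slabSpec β A B) suFrobDist slabNbr (fun x y => K * |β| * (slabInfluence x y : ℝ)) := by
  classical
  refine ⟨not_mem_slabNbr hL, fun x y => by positivity, fun x η η' h => ?_, ?_⟩
  · rw [siteLaw_slabSpec_thooft β A B x η hL, siteLaw_slabSpec_thooft β A B x η' hL, slabField, slabField,
      slabStapleSum_congr A B x h]
  · intro x y _ ω η hωη φ Lφ hφm hφb hL0 hφL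
    rw [siteLaw_slabSpec_thooft β A B x ω hL, siteLaw_slabSpec_thooft β A B x η hL]
    have hBω : matrixOpNorm (slabField β A B ω x) ≤ R := (matrixOpNorm_slabField_le hN β A B ω x).trans hR
    have hBη : matrixOpNorm (slabField β A B η x) ≤ R := (matrixOpNorm_slabField_le hN β A B η x).trans hR
    refine (hmod _ _ hBω hBη φ Lφ hφm hφb hL0 hφL).trans ?_
    have hdiff := frobNorm_slabField_sub_le β A B x y hωη
    calc K * Lφ * frobNorm (slabField β A B ω x - slabField β A B η x)
        ≤ K * Lφ * (|β| * slabInfluence x y * suFrobDist (ω y) (η y)) :=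
          mul_le_mul_of_nonneg_left hdiff (mul_nonneg hK hL0)
      _ = K * |β| * (slabInfluence x y : ℝ) * Lφ * suFrobDist (ω y) (η y) := by ring

/-- Row sums of the slab influence coefficients: `∑_y C(x,y) ≤ 2n|β|K`. [folklore] -/
theorem slab_rowsum_le (x : TorusSite n L) {β K : ℝ} (hK : 0 ≤ K) :
    ∑ y ∈ slabNbr x, K * |β| * (slabInfluence x y : ℝ) ≤ 2 * (n : ℝ) * |β| * K := by
  rw [← Finset.mul_sum]
  have h : ∑ y ∈ slabNbr x, (slabInfluence x y : ℝ) ≤ 2 * (n : ℝ) := by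
    exact_mod_cast sum_slabInfluence_le x
  calc K * |β| * ∑ y ∈ slabNbr x, (slabInfluence x y : ℝ) ≤ K * |β| * (2 * (n : ℝ)) :=
        mul_le_mul_of_nonneg_left h (by positivity)
    _ = 2 * (n : ℝ) * |β| * K := by ring

/-! ### The door: boundary-uniform covariance decay on the slab -/

/-- **Slab Dobrushin door (covariance form).**  Let `n ≥ 0`, `N ≥ 1`, `L ≠ 1` (no loops), a 't Hooft coupling `β`, a
radius `R ≥ 2n|β|` with a one-link Kantorovich–Rubinstein modulus `OneLinkKRModulus N R K`, and Dobrushin constant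
`c := 2n|β|K ≤ 1`.  Then for ALL boundary fields `A, B ∈ U(N)^{edges}` and all bounded measurable observables `f`, `g`
depending on the single sites `x`, `y` with Frobenius-Lipschitz constants `δf`, `δg`, and every profile `ℓ` vanishing at
`y` and 1-Lipschitz along slab edges (e.g. the graph distance to `y`),
`|Cov_{μ_{A,B}}(f, g)| ≤ 2 (2√N)² δg δf c^{ℓ x}` — a bound with NO dependence on `A`, `B`, `L` beyond `c`.
This is the hypothesis (H_DF) of Durhuus–Fröhlich / Cao–Nissim–Sheffield Thm. 2.3 (area law) for the matrix-entry
observables, up to their named theorem. [cite: CaoNissimSheffield2025dynamical, Def. 2.1 and Thm. 2.3] [cite: Follmer1988, Ch. I Theorem (2.13)] -/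
theorem slab_covariance_le (hN : 1 ≤ N) (hL : ∀ e : SlabEdge n L, e.tgt ≠ e.1) {β R K : ℝ} (hK : 0 ≤ K)
    (hR : |β| * (2 * (n : ℝ)) ≤ R) (hmod : OneLinkKRModulus N R K) (hc1 : 2 * (n : ℝ) * |β| * K ≤ 1)
    (A B : SlabEdge n L → Matrix.unitaryGroup (Fin N) ℂ) (x y : TorusSite n L)
    {f g : SlabConfig n L N → ℝ} (hfm : Measurable f) (hfdep : DependsOn f ({x} : Set (TorusSite n L)))
    {Mf : ℝ} (hMf : ∀ σ, |f σ| ≤ Mf) {δf : ℝ} (hδf : IsLipBound suFrobDist f fun z => if z = x then δf else 0)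
    (hgm : Measurable g) (hgdep : DependsOn g ({y} : Set (TorusSite n L))) {Mg : ℝ} (hMg : ∀ σ, |g σ| ≤ Mg)
    {δg : ℝ} (hδg : IsLipBound suFrobDist g fun z => if z = y then δg else 0)
    (ℓ : TorusSite n L → ℕ) (hℓ0 : ℓ y = 0) (hℓ : ∀ z, z ≠ y → ∀ w ∈ slabNbr z, ℓ z ≤ ℓ w + 1) :
    |cov[f, g; slabMeasure β A B]| ≤
      2 * (2 * Real.sqrt N) ^ 2 * δg * ((2 * (n : ℝ) * |β| * K) ^ ℓ x * δf) := by
  classical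
  have hγ := isSpecification_slabSpec (n := n) (L := L) β A B
  have hKR := isKRContraction_slabSpec hN hL hK hR hmod A B
  have hc0 : 0 ≤ 2 * (n : ℝ) * |β| * K := by positivity
  have key := abs_covariance_le_of_isKRContraction hγ hKR suFrobDist_nonneg suFrobDist_le (by positivity) hc0 hc1
    (fun z => slab_rowsum_le z hK) (isGibbsMeasure_slabMeasure β A B) hfm (Δf := {x}) (by simpa using hfdep) hMf hδf
    hgm (Δg := {y}) (by simpa using hgdep) hMg hδg ℓ (fun z hz => by rw [Finset.mem_singleton.1 hz, hℓ0])
    (fun z hz w hw => hℓ z (by simpa using hz) w hw)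
  simpa using key

/-! ### No loops for `L ≥ 2`; the `SU(2)`, `d = 4` instance in Wilson units -/

omit [NeZero L] in
/-- For `L ≠ 1` no slab edge is a loop: `x + e_i ≠ x` in `(ℤ/L)^n`. [folklore] -/
theorem SlabEdge.tgt_ne_fst (hL : L ≠ 1) (e : SlabEdge n L) : e.tgt ≠ e.1 := by
  intro h
  have h1 := congrFun h e.2
  simp only [SlabEdge.tgt, Function.update_self] at h1
  have : (1 : ZMod L) = 0 := by
    have := add_left_cancel (a := e.1 e.2) (b := 1) (c := 0) (by rw [add_zero]; exact h1)
    exact this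
  exact hL ((ZMod.one_eq_zero_iff).1 this)

/-- **`SU(2)` slab door in Wilson units, `d = 4` (slice dimension `n = 3`).**  With the tree's certificate schema
`OneLinkKRModulusSU2 βW K₂ := OneLinkKRModulus 2 (3βW/2) (4K₂)` ('t Hooft `β = βW/4`, so `2n|β| = 3βW/2` is exactly the
schema's radius) and Dobrushin constant `c = 6 βW K₂ ≤ 1`: boundary-uniform single-site covariance decay
`|Cov_{μ_{A,B}}(f,g)| ≤ 2(2√2)² δg δf c^{ℓ x}` on every slab `(ℤ/L)³`, `L ≥ 2`.  With the in-tree quarter modulus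
(`K₂ = 1/4` for `βW ≤ 2/7`, pub-balaban leaves (33·x)) this gives `c = 3βW/2 ≤ 3/7 < 1` for all `βW ≤ 2/7` — the input of
the Durhuus–Fröhlich area-law criterion, NOT the area law itself (that needs CNS25 Thm. 2.3 as a named fact).
[cite: CaoNissimSheffield2025dynamical, Def. 2.1 and Thm. 2.3] -/
theorem su2_slab_covariance_le {L : ℕ} [NeZero L] (hL : L ≠ 1) {βW K₂ : ℝ} (hβ : 0 ≤ βW) (hK : 0 ≤ K₂)
    (hmod : OneLinkKRModulusSU2 βW K₂) (hc1 : 6 * βW * K₂ ≤ 1)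
    (A B : SlabEdge 3 L → Matrix.unitaryGroup (Fin 2) ℂ) (x y : TorusSite 3 L)
    {f g : SlabConfig 3 L 2 → ℝ} (hfm : Measurable f) (hfdep : DependsOn f ({x} : Set (TorusSite 3 L)))
    {Mf : ℝ} (hMf : ∀ σ, |f σ| ≤ Mf) {δf : ℝ} (hδf : IsLipBound suFrobDist f fun z => if z = x then δf else 0)
    (hgm : Measurable g) (hgdep : DependsOn g ({y} : Set (TorusSite 3 L))) {Mg : ℝ} (hMg : ∀ σ, |g σ| ≤ Mg)
    {δg : ℝ} (hδg : IsLipBound suFrobDist g fun z => if z = y then δg else 0)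
    (ℓ : TorusSite 3 L → ℕ) (hℓ0 : ℓ y = 0) (hℓ : ∀ z, z ≠ y → ∀ w ∈ slabNbr z, ℓ z ≤ ℓ w + 1) :
    |cov[f, g; slabMeasure (βW / 4) A B]| ≤
      2 * (2 * Real.sqrt 2) ^ 2 * δg * ((6 * βW * K₂) ^ ℓ x * δf) := by
  have hβ' : |βW / 4| = βW / 4 := abs_of_nonneg (by positivity)
  have hR : |βW / 4| * (2 * ((3 : ℕ) : ℝ)) ≤ 3 * βW / 2 := by rw [hβ']; push_cast; linarith
  have hc : 2 * ((3 : ℕ) : ℝ) * |βW / 4| * (4 * K₂) = 6 * βW * K₂ := by rw [hβ']; push_cast; ring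
  have key := slab_covariance_le (n := 3) (L := L) (N := 2) (by norm_num) (SlabEdge.tgt_ne_fst hL)
    (β := βW / 4) (R := 3 * βW / 2) (K := 4 * K₂) (by positivity) hR hmod (by rw [hc]; exact hc1) A B x y hfm hfdep hMf
    hδf hgm hgdep hMg hδg ℓ hℓ0 hℓ
  rw [hc] at key
  simpa using key

end Summit.Ventures.YMGap.Slab
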